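import Summits.QuantumFields.BalabanUV.Beta.GAN24.SecondOrderCarrierParity
import Summits.QuantumFields.BalabanUV.Beta.GAN24.WrecAtSlotRowsFinal
import Summits.QuantumFields.BalabanUV.Beta.GAN24.T2RecursionAffine

/-!
# `BalabanUV.Beta.GAN24.WrecAtEvenHalfRows` — binder row G-an2-4 ∕ (CONV-C), W-slot EXIT (α) «use the identity, not its defect» (RULING R-lead-g77-1 (2); the OWNER
# gan24-p1 g33's RULING R-gan24p1-g33-1 (C2), `ALPHA0-STATUS` link L9 «capstone re-run on the even carrier, response word dropped»): **THE W-SLOT ROWS (hW, hWall)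
# OF THE EVEN HALF `½ • (W⁰_j + P W⁰_j)` OF an2's RECURSIVE WALL FAMILY `W⁰ = WrecAt` AS FUNCTIONS OF THE EVEN MEMBER's TWO T₂ ROWS «T2Shape^{ev}» ∧ «T2Drift^{ev}»**
# (`P := sgnK ∘ trK` slotwise; generic `d`, in-block root; the dressed K-rows and «S′Shape» ∧ «S′Drift» as letters — PART 2 `WrecAtEvenHalfRowsFinal` discharges them at `d = 3`)

NOT IN PRINT; OUR BOOKKEEPING (road-P2 chair of row G-an2-4, unit `b2b-balaban-gan24-p2` gen 45, crux team (2); journal `CLAIMS.log` [GAN24P2-G45-INTENT1]).  HONEST FRAMING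
(cell contract, verbatim): «discharging `BetaPertH` makes Bałaban's UV stability UNCONDITIONAL — a real constructive-QFT result; it is NOT the continuum limit and NOT the
Clay problem.»  HONEST DEPENDENCY (verbatim): «continuum YM on T⁴ ⇐ BetaPertH ∧ nine spine estimates (0/9 proved); BetaPertH ⇐ (D1) ∧ (D4) ∧ CAP+tail; G-an2-4 gates asym,
D1 and NE2/3/4.»

WHAT ([folklore] kernel bookkeeping BY NAME; 0 `def`, 0 cited facts, 0 `def … : Prop`, 0 sorry).  After the parity re-cut (α-0) the D1 END reads the W-literal only through its EVEN
half (the OWNER's `WSlotParityBlind`, leaf-01 g71's `WSlotParityJunction`): the odd half — (β) of record — is never read.  leaf-03 g65's carrier law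
(`SecondOrderCarrierParity.evenHalf_WrecAt`) says the even half of `W⁰_j = W2SymOfK G_j Lc S_j M_j T₂,j M₂,j` is the symmetrised carrier on the EVEN halves of the two
second-order tables MINUS its symmetrised second-response word; §0 identifies that word with the carrier AT ZERO second-order tables (`W2SymOfK_zero_zero`), so that in any
units (§1 `unitW_evenHalf_WrecAt`; the parity half commutes with the units, `unitS₂_evenHalf` ∕ `unitM₂_evenHalf`)
  `unitW_j ((W⁰_j)^{ev}) = W2SymOfK G̃_j Lc S̃_j M̃_j ((T̃₂,j)^{ev}) ((M̃₂,j)^{ev}) − W2SymOfK G̃_j Lc S̃_j M̃_j 0 0`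
with `(T̃₂,j)^{ev} = ½ • (unitS₂_j T₂,j + P (unitS₂_j T₂,j))` — EXACTLY the OWNER's `T2ShapeEvenEnd` member at `ε = 1`.  §2 gives the uniform and the geometric-Cauchy
`VertexFamily₂` rows of the carrier over the literal's normalised first-order slots with ANY second-order tables (an1's `vertexFamily₂_W2SymOfK`, leaf-07's
`vertexFamily₂_W2SymOfK_sub` — the pattern of MY gen-35 `WrecAtSlotOfShapes` ∕ `T2RecSourceRows`); §3 **`hW_hWall_evenHalf_WrecAt_of_shapes`** applies §2 TWICE (tables
`((T̃₂)^{ev}, mixFF^{ev})` and `(0, 0)`) and subtracts: (hW, hWall) OF THE EVEN HALF ⟸ dressed K-rows ∧ «S′Shape» ∧ «S′Drift» ∧ «T2Shape^{ev}» ∧ «T2Drift^{ev}» (+ the border ∕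
mixed binders `hB hmix hfm hm`, which only size the raw tables), ONE ratio, ONE rate; the left sides spelled EXACTLY as `WSlotParityJunction`'s even-half `hW` ∕ `hWall`.
Asserts NO bound on Bałaban's tables beyond the displayed rows; discharges NOTHING of «T2Shape^{ev}» ∕ «T2Drift^{ev}» ∕ (C) ∕ (Q-L) ∕ `hcell` ∕ `hb` ∕ `hZ` (the OWNER's (α-END));
(β) of record untouched; NEVER «G-an2-4 closed» as (CONV-C); NOT D1, NOT `BetaPertH`, NOT continuum, NOT Clay; not in print — our bookkeeping.  2026-08-23.
-/

noncomputable section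

open Finset
open scoped BigOperators
open Literature.MathematicalPhysics.QuantumFieldTheory
open Literature.MathematicalPhysics.QuantumFieldTheory.Balaban1983to89
open Literature.MathematicalPhysics.QuantumFieldTheory.Balaban1983to89.Beta
open B12Sec2to5 (l1 l1_nonneg)
open ExpKernelCalculus (MKer Decays BiLoc VertexFamily VertexFamily₂ Zl)
open OneStepResolventKernel (Fib LocStencil decays_mono biLoc_mono bound_mono)
open OneStepKernelFamily (KInvStep)
open AffineAveraging (box toSite)
open AveragingHessianKernels (ell)
open AveragingHessianKernelsRooted (hessFFAt hessFFAt_inl_inr hessFFAt_inr biLoc_hessFFAt)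
open AveragingMixedJetTables (mixFFAt mixFFAt_inl_inr mixFFAt_inr)
open InterLevelTransport (cwsum cwsum_apply)
open BalabanStepJets (vertexFamily₂_mono)
open Summit.QuantumFields.BalabanUV.Beta.HessKerConvCKPlug (vertexFamily₂_mono')
open BalabanCompositeJets (LocStencil₂)
open SecondOrderResponse (vertexOfM dM K2OfK vertex2OfK mixOfK W2OfK W2SymOfK W2OfK_apply LocStencilFM vertexFamily₂_W2SymOfK CW2)
open BalabanStepW2 (M2Of wM1)
open Summit.QuantumFields.BalabanUV.Beta.TameKernelCalculus (trK trK_apply)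
open Summit.QuantumFields.BalabanUV.Beta.BorderedHessian (sgnF sgnK sgnK_apply)
open Summit.QuantumFields.BalabanUV.Beta.HessKerDressedUnits (unitK unitS unitW unitW_sub unitW_apply legScale legScale_inl legScale_inr)
open Summit.QuantumFields.BalabanUV.Beta.SecondOrderUnits (unitM unitS₂ unitM₂ unitM_apply unitW_W2SymOfK)
open Summit.QuantumFields.BalabanUV.Beta.AxialDressingRooted (coDressKBmAt)
open Summit.QuantumFields.BalabanUV.Beta.SpineRooted (SpureRecAt T2RecAt WrecAt M1At)
open Summit.QuantumFields.BalabanUV.Beta.HessKerCoDressedBmWall (exists_coDressedBm_unit_rows)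
open Summit.QuantumFields.BalabanUV.Beta.MixedJetTablesPlug (hmix_an1)
open Summit.QuantumFields.BalabanUV.Beta.GAN24.CombesThomas (sfStep smStep UnitDecayK CauchyDecayK sfStep_ne_zero smStep_ne_zero)
open Summit.QuantumFields.BalabanUV.Beta.GAN24.KSlotAssembly (convCKWall_holds)
open Summit.QuantumFields.BalabanUV.Beta.GAN24.StencilSlotOfShapes (locStencil_mono')
open Summit.QuantumFields.BalabanUV.Beta.GAN24.WSlotOfShapes (m1_unit_factor unitM₂_M2Of_eq locStencilFM_unitM₂_M2Of)
open Summit.QuantumFields.BalabanUV.Beta.GAN24.WSlotCauchyOfShapes (locStencil₂_le_mono vertexFamily_zero locStencilFM_zero mul_pow_le_mul_pow)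
open Summit.QuantumFields.BalabanUV.Beta.GAN24.SecondOrderLipschitzW2 (LW2 LW2_mul vertexFamily₂_W2SymOfK_sub)
open Summit.QuantumFields.BalabanUV.Beta.GAN24.T2SlotUnits (unitS₂_apply)
open Summit.QuantumFields.BalabanUV.Beta.GAN24.T2RecursionAffine (vertexOfK_zero_table vertex2OfK_zero)
open Summit.QuantumFields.BalabanUV.Beta.GAN24.W3SourceRows (unitS₂_zero locStencil₂_zero_table)
open Summit.QuantumFields.BalabanUV.Beta.GAN24.WSlotSupRate (vertexFamily₂_sub')
open Summit.QuantumFields.BalabanUV.Beta.GAN24.WrecAtSlotOfShapes (unitW_WrecAt unitM_M1At_eq vertexFamily_smul_hessFFAt)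
open Summit.QuantumFields.BalabanUV.Beta.GAN24.SecondOrderCarrierParity (evenHalf_WrecAt locStencilFM_evenHalf)

namespace Summit.QuantumFields.BalabanUV.Beta.GAN24.WrecAtEvenHalfRows

variable {d : ℕ}

/-! ## §0 The symmetrised second-response word as the carrier at zero second-order tables; the parity half commutes with the units -/

section Zero

variable {N : ℕ} [NeZero N] (K : MKer (d + 1) (Fib d)) (S M : Fin (d + 1) → (Fin (d + 1) → ℤ) → MKer (d + 1) (Fib d))

/-- [folklore] The multiplier-chart vertex of the ZERO table is the zero kernel (every term of every coarse series is `0`). -/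
theorem vertexOfM_zero_table (μ : Fin (d + 1)) (y : Fin (d + 1) → ℤ) :
    vertexOfM K N (0 : Fin (d + 1) → (Fin (d + 1) → ℤ) → MKer (d + 1) (Fib d)) μ y = 0 := by
  funext x z a b
  simp only [vertexOfM, Pi.zero_apply, cwsum_apply, mul_zero, tsum_zero, Finset.sum_const_zero]

/-- [folklore] The mixed bi-vertex of the ZERO field–multiplier table is the zero kernel. -/
theorem mixOfK_zero (μ : Fin (d + 1)) (y : Fin (d + 1) → ℤ) (ν : Fin (d + 1)) (y' : Fin (d + 1) → ℤ) :
    mixOfK K N (0 : Fin (d + 1) → (Fin (d + 1) → ℤ) → Fin (d + 1) → (Fin (d + 1) → ℤ) → MKer (d + 1) (Fib d)) μ y ν y' = 0 := by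
  unfold mixOfK
  have h : (fun κ u => vertexOfM K N ((0 : Fin (d + 1) → (Fin (d + 1) → ℤ) → Fin (d + 1) → (Fin (d + 1) → ℤ) →
      MKer (d + 1) (Fib d)) κ u) ν y') = (0 : Fin (d + 1) → (Fin (d + 1) → ℤ) → MKer (d + 1) (Fib d)) := by
    funext κ u
    simp only [Pi.zero_apply]
    exact vertexOfM_zero_table K ν y'
  rw [h]
  exact vertexOfK_zero_table K N μ y

/-- [folklore] **THE SYMMETRISED SECOND-RESPONSE WORD IS THE CARRIER AT ZERO SECOND-ORDER TABLES**:
`W2SymOfK K N S M 0 0 μ y ν y′ = ½ • (dM (K2OfK K N S M ν y′) N S M μ y + dM (K2OfK K N S M μ y) N S M ν y′)`. -/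
theorem W2SymOfK_zero_zero (μ : Fin (d + 1)) (y : Fin (d + 1) → ℤ) (ν : Fin (d + 1)) (y' : Fin (d + 1) → ℤ) :
    W2SymOfK K N S M 0 0 μ y ν y' = (1 / 2 : ℝ) • (dM (K2OfK K N S M ν y') N S M μ y + dM (K2OfK K N S M μ y) N S M ν y') := by
  unfold W2SymOfK
  rw [W2OfK_apply, W2OfK_apply]
  simp only [vertex2OfK_zero, mixOfK_zero, zero_add]

end Zero

section Units

variable (sf sm : ℝ)

/-- [folklore] **THE PARITY HALF COMMUTES WITH THE SECOND-ORDER TABLE UNITS** (`legScale` is one scalar per leg, symmetric under the leg swap):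
`unitS₂ (½ • (T + P T)) = ½ • (unitS₂ T + P (unitS₂ T))`, `P := sgnK ∘ trK` slotwise — written with the OWNER's table-level spelling on the right. -/
theorem unitS₂_evenHalf (T : Fin (d + 1) → (Fin (d + 1) → ℤ) → Fin (d + 1) → (Fin (d + 1) → ℤ) → MKer (d + 1) (Fib d)) :
    unitS₂ sf sm (fun κ u κ' u' => (1 / 2 : ℝ) • (T κ u κ' u' + sgnK (trK (T κ u κ' u')))) =
      ((1 : ℝ) / 2) • (unitS₂ sf sm T + fun κ u κ' u' => sgnK (trK (unitS₂ sf sm T κ u κ' u'))) := by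
  funext κ u κ' u' x z a b
  simp only [unitS₂_apply, Pi.smul_apply, Pi.add_apply, smul_eq_mul, sgnK_apply, trK_apply]
  ring

/-- [folklore] The same for the mixed field–multiplier units: `unitM₂ (½ • (M₂ + P M₂)) = ½ • (unitM₂ M₂ + P (unitM₂ M₂))` (slot-level spelling). -/
theorem unitM₂_evenHalf (M₂ : Fin (d + 1) → (Fin (d + 1) → ℤ) → Fin (d + 1) → (Fin (d + 1) → ℤ) → MKer (d + 1) (Fib d)) :
    unitM₂ sf sm (fun κ u ρ w => (1 / 2 : ℝ) • (M₂ κ u ρ w + sgnK (trK (M₂ κ u ρ w)))) =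
      fun κ u ρ w => (1 / 2 : ℝ) • (unitM₂ sf sm M₂ κ u ρ w + sgnK (trK (unitM₂ sf sm M₂ κ u ρ w))) := by
  funext κ u ρ w x z a b
  simp only [unitM₂, unitM_apply, Pi.smul_apply, Pi.add_apply, smul_eq_mul, sgnK_apply, trK_apply]
  ring

/-- [folklore] `unitM₂` of the zero table is the zero table. -/
theorem unitM₂_zero :
    unitM₂ sf sm (0 : Fin (d + 1) → (Fin (d + 1) → ℤ) → Fin (d + 1) → (Fin (d + 1) → ℤ) → MKer (d + 1) (Fib d)) = 0 := by
  funext κ u ρ w x z a b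
  simp only [unitM₂, unitM_apply, Pi.smul_apply, Pi.zero_apply, smul_eq_mul, mul_zero, zero_mul]

end Units

/-! ## §1 The even half of the W-literal, in the adopted units, is a DIFFERENCE of two symmetrised carriers over the normalised first-order slots -/

section Literal

variable {Lc : ℕ} [NeZero Lc] {r : Fin (d + 1) → ℕ}

/-- [folklore] **THE EVEN HALF OF `WrecAt … j` IN ANY UNITS = THE CARRIER ON THE EVEN HALVES OF THE NORMALISED SECOND-ORDER TABLES MINUS THE CARRIER AT
ZERO SECOND-ORDER TABLES** (in-block root `toSite r`; binders `hB`, `hmix` of `SpineRecursiveW` for the entrywise bounds): leaf-03 g65's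
`SecondOrderCarrierParity.evenHalf_WrecAt` ⨾ `W2SymOfK_zero_zero` ⨾ `unitW_sub` ⨾ `unitW_W2SymOfK` ⨾ `unitS₂_evenHalf` ∕ `unitM₂_evenHalf` ∕ `unitS₂_zero` ∕ `unitM₂_zero`.
The left side is spelled EXACTLY as leaf-01 g71's `WSlotParityJunction` spells the even-half W-slot rows; the `S₂`-slot on the right EXACTLY as the OWNER's
`T2ShapeEvenEnd` spells the even member (`ε = 1`, `one_smul`). -/
theorem unitW_evenHalf_WrecAt (hLc : 1 ≤ Lc) (hr : r ∈ box (d + 1) Lc) (cE cVH cΛ cE₂ cB : ℝ) (T : Fin 4 → Fin 4 → Fin 4 → Fin 4 → ℝ)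
    (vh₂S mixFF : Fin (d + 1) → (Fin (d + 1) → ℤ) → Fin (d + 1) → (Fin (d + 1) → ℤ) → MKer (d + 1) (Fib d))
    (hB : ∃ C δ : ℝ, 0 < δ ∧ LocStencil₂ vh₂S C δ) (hmix : ∃ C δ : ℝ, 0 < δ ∧ LocStencilFM Lc mixFF C δ) {sf sm : ℝ} (hsf : sf ≠ 0) (hsm : sm ≠ 0)
    (j : ℕ) :
    unitW sf sm (fun μ y ν y' => ((1 : ℝ) / 2) • (WrecAt d Lc (toSite r) cE cVH cΛ cE₂ cB T vh₂S mixFF j μ y ν y'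
        + sgnK (trK (WrecAt d Lc (toSite r) cE cVH cΛ cE₂ cB T vh₂S mixFF j μ y ν y')))) =
      W2SymOfK (unitK sf sm (coDressKBmAt (toSite r) Lc (KInvStep (d := d) Lc j))) Lc (unitS sf sm (SpureRecAt d Lc (toSite r) cE cVH cΛ j))
          (unitM sf sm (M1At d Lc (toSite r) cΛ j))
          (((1 : ℝ) / 2) • (unitS₂ sf sm (T2RecAt d Lc (toSite r) cE cVH cΛ cE₂ cB T vh₂S mixFF j) + fun κ u κ' u' =>
            sgnK (trK (unitS₂ sf sm (T2RecAt d Lc (toSite r) cE cVH cΛ cE₂ cB T vh₂S mixFF j) κ u κ' u'))))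
          (fun κ u ρ w => (1 / 2 : ℝ) • (unitM₂ sf sm (M2Of d Lc mixFF j) κ u ρ w + sgnK (trK (unitM₂ sf sm (M2Of d Lc mixFF j) κ u ρ w)))) -
        W2SymOfK (unitK sf sm (coDressKBmAt (toSite r) Lc (KInvStep (d := d) Lc j))) Lc (unitS sf sm (SpureRecAt d Lc (toSite r) cE cVH cΛ j))
          (unitM sf sm (M1At d Lc (toSite r) cΛ j)) 0 0 := by
  have e : (fun μ y ν y' => ((1 : ℝ) / 2) • (WrecAt d Lc (toSite r) cE cVH cΛ cE₂ cB T vh₂S mixFF j μ y ν y'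
        + sgnK (trK (WrecAt d Lc (toSite r) cE cVH cΛ cE₂ cB T vh₂S mixFF j μ y ν y')))) =
      W2SymOfK (coDressKBmAt (toSite r) Lc (KInvStep (d := d) Lc j)) Lc (SpureRecAt d Lc (toSite r) cE cVH cΛ j) (M1At d Lc (toSite r) cΛ j)
          (fun κ u κ' u' => (1 / 2 : ℝ) • (T2RecAt d Lc (toSite r) cE cVH cΛ cE₂ cB T vh₂S mixFF j κ u κ' u'
            + sgnK (trK (T2RecAt d Lc (toSite r) cE cVH cΛ cE₂ cB T vh₂S mixFF j κ u κ' u'))))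
          (fun κ u ρ w => (1 / 2 : ℝ) • (M2Of d Lc mixFF j κ u ρ w + sgnK (trK (M2Of d Lc mixFF j κ u ρ w)))) -
        W2SymOfK (coDressKBmAt (toSite r) Lc (KInvStep (d := d) Lc j)) Lc (SpureRecAt d Lc (toSite r) cE cVH cΛ j) (M1At d Lc (toSite r) cΛ j) 0 0 := by
    funext μ y ν y'
    simp only [Pi.sub_apply]
    rw [W2SymOfK_zero_zero, evenHalf_WrecAt hLc hr cE cVH cΛ cE₂ cB T vh₂S mixFF hB hmix j μ y ν y']
  rw [e, unitW_sub, unitW_W2SymOfK (N := Lc) hsf hsm, unitW_W2SymOfK (N := Lc) hsf hsm, unitS₂_zero, unitM₂_zero, unitS₂_evenHalf,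
    unitM₂_evenHalf]

end Literal

/-! ## §2 Generic `d`: the symmetrised carrier over the literal's normalised first-order slots, with ANY second-order tables — uniform and Cauchy rows -/

section Carrier

variable {Lc : ℕ} [NeZero Lc] {r : Fin (d + 1) → ℕ} (cE cVH cΛ : ℝ)

/-- NOT IN PRINT; OUR BOOKKEEPING — A SOCKET ([folklore] assembly; generic `d`, in-block root).  **THE SYMMETRISED CARRIER OVER THE LITERAL's NORMALISED FIRST-ORDER
SLOTS WITH ANY `j`-UNIFORM `LocStencil₂` FAMILY `U j` IN THE `S₂`-SLOT AND ANY `j`-FREE `LocStencilFM` TABLE `N₂` IN THE `M₂`-SLOT IS `j`-UNIFORMLY A VERTEX FAMILY**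
(dressed K uniform row `hG`, «S′Shape» `hS`; the multiplier slot `unitM_j (M1At … j) = cΛ • hessFFAt` is `j`-free — `unitM_M1At_eq`; an1's `vertexFamily₂_W2SymOfK` at the common rate).
The twin of MY gen-35 `T2RecSourceRows.vertexFamily₂_zeroCarrier_of_rows` with the two second-order slots free. -/
theorem vertexFamily₂_carrier_of_rows (hLc : 1 ≤ Lc) (hr : r ∈ box (d + 1) Lc) {C δ : ℝ}
    (hG : ∀ j, Decays (unitK (sfStep Lc j) (smStep d Lc j) (coDressKBmAt (toSite r) Lc (KInvStep (d := d) Lc j))) C δ) (hδ : 0 < δ)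
    {Cs δs : ℝ} (hS : ∀ j, LocStencil (unitS (sfStep Lc j) (smStep d Lc j) (SpureRecAt d Lc (toSite r) cE cVH cΛ j)) Cs δs) (hδs : 0 < δs)
    {U : ℕ → Fin (d + 1) → (Fin (d + 1) → ℤ) → Fin (d + 1) → (Fin (d + 1) → ℤ) → MKer (d + 1) (Fib d)} {C₂ δ₂ : ℝ}
    (hU : ∀ j, LocStencil₂ (U j) C₂ δ₂) (hδ₂ : 0 < δ₂)
    {N₂ : Fin (d + 1) → (Fin (d + 1) → ℤ) → Fin (d + 1) → (Fin (d + 1) → ℤ) → MKer (d + 1) (Fib d)} {CM₂ δ₄ : ℝ}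
    (hN : LocStencilFM Lc N₂ CM₂ δ₄) (hδ₄ : 0 < δ₄) :
    ∃ Cw δW : ℝ, 0 < δW ∧ ∀ j, VertexFamily₂ (W2SymOfK (unitK (sfStep Lc j) (smStep d Lc j) (coDressKBmAt (toSite r) Lc (KInvStep (d := d) Lc j))) Lc
      (unitS (sfStep Lc j) (smStep d Lc j) (SpureRecAt d Lc (toSite r) cE cVH cΛ j)) (unitM (sfStep Lc j) (smStep d Lc j) (M1At d Lc (toSite r) cΛ j)) (U j) N₂)
      Lc Cw δW := by
  have hC : 0 ≤ C := (hG 0).nonneg (Sum.inl 0)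
  have hCs : 0 ≤ Cs := ((hS 0) 0 0).nonneg (Sum.inl 0)
  set m : ℝ := min (min (min δ δs) δ₂) δ₄ with hm_def
  have hm0 : 0 < m := lt_min (lt_min (lt_min hδ hδs) hδ₂) hδ₄
  have hm4 : m ≤ δ₄ := min_le_right _ _
  have hm2 : m ≤ δ₂ := (min_le_left _ _).trans (min_le_right _ _)
  have hms : m ≤ δs := (min_le_left _ _).trans ((min_le_left _ _).trans (min_le_right _ _))
  have hmK : m ≤ δ := (min_le_left _ _).trans ((min_le_left _ _).trans (min_le_left _ _))
  set CM : ℝ := |cΛ| * (2 * (ell (d + 1) Lc : ℝ) ^ 2 * Real.exp (4 * ((d : ℝ) + 1) * Lc * m)) with hCM_def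
  refine ⟨CW2 d C Cs CM C₂ CM₂ m, m / 16, by positivity, fun j => ?_⟩
  have hK' : Decays (unitK (sfStep Lc j) (smStep d Lc j) (coDressKBmAt (toSite r) Lc (KInvStep (d := d) Lc j))) C m :=
    decays_mono (hG j) hC le_rfl hmK
  have hS' : LocStencil (unitS (sfStep Lc j) (smStep d Lc j) (SpureRecAt d Lc (toSite r) cE cVH cΛ j)) Cs m :=
    locStencil_mono' (hS j) le_rfl hms
  have hM' : VertexFamily (unitM (sfStep Lc j) (smStep d Lc j) (M1At d Lc (toSite r) cΛ j)) Lc CM m := by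
    rw [unitM_M1At_eq]
    exact vertexFamily_smul_hessFFAt hLc hr cΛ hm0.le
  have hT' : LocStencil₂ (U j) C₂ m := (hU j).mono hm2
  have hX' : LocStencilFM Lc N₂ CM₂ m := hN.mono hm4
  exact vertexFamily₂_W2SymOfK hK' hC hm0 hS' hM' hT' hX'

/-- NOT IN PRINT; OUR BOOKKEEPING — A SOCKET ([folklore] assembly; generic `d`, in-block root).  **THE SAME CARRIER FAMILY IS CAUCHY AT A GEOMETRIC RATE**: + the dressed
K Cauchy row `hGall` (ratio `θK`), «S′Drift» `hSall` (ratio `θS`) and the drift row of the `S₂`-slot family `hUd` (ratio `θ₂`) ⇒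
`∀ k j, VertexFamily₂ (𝒲_{k+j} − 𝒲_k) Lc (cW·θW^k) δW`, `θW = max θK (max θS θ₂)` (leaf-07's `vertexFamily₂_W2SymOfK_sub`; the multiplier and `M₂` slots do not move).
The twin of MY gen-35 `WrecAtSlotOfShapes.hWall_WrecAt_of_shapes` with the two second-order slots free. -/
theorem vertexFamily₂_carrier_cauchy_of_rows (hLc : 1 ≤ Lc) (hr : r ∈ box (d + 1) Lc) {C δ cK θK : ℝ}
    (hG : ∀ j, Decays (unitK (sfStep Lc j) (smStep d Lc j) (coDressKBmAt (toSite r) Lc (KInvStep (d := d) Lc j))) C δ)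
    (hGall : ∀ k j, Decays (unitK (sfStep Lc (k + j)) (smStep d Lc (k + j)) (coDressKBmAt (toSite r) Lc (KInvStep (d := d) Lc (k + j))) -
      unitK (sfStep Lc k) (smStep d Lc k) (coDressKBmAt (toSite r) Lc (KInvStep (d := d) Lc k))) (cK * θK ^ k) δ)
    (hδ : 0 < δ) (hθK0 : 0 ≤ θK) (hθK1 : θK < 1)
    {Cs cS θS δs : ℝ} (hS : ∀ j, LocStencil (unitS (sfStep Lc j) (smStep d Lc j) (SpureRecAt d Lc (toSite r) cE cVH cΛ j)) Cs δs)
    (hSall : ∀ k j, LocStencil (unitS (sfStep Lc (k + j)) (smStep d Lc (k + j)) (SpureRecAt d Lc (toSite r) cE cVH cΛ (k + j)) -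
      unitS (sfStep Lc k) (smStep d Lc k) (SpureRecAt d Lc (toSite r) cE cVH cΛ k)) (cS * θS ^ k) δs)
    (hδs : 0 < δs) (hθS0 : 0 ≤ θS) (hθS1 : θS < 1)
    {U : ℕ → Fin (d + 1) → (Fin (d + 1) → ℤ) → Fin (d + 1) → (Fin (d + 1) → ℤ) → MKer (d + 1) (Fib d)} {C₂ c₂ θ₂ δ₂ : ℝ}
    (hU : ∀ j, LocStencil₂ (U j) C₂ δ₂) (hUd : ∀ k j, LocStencil₂ (U (k + j) - U k) (c₂ * θ₂ ^ k) δ₂)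
    (hδ₂ : 0 < δ₂) (hθ₂0 : 0 ≤ θ₂) (hθ₂1 : θ₂ < 1)
    {N₂ : Fin (d + 1) → (Fin (d + 1) → ℤ) → Fin (d + 1) → (Fin (d + 1) → ℤ) → MKer (d + 1) (Fib d)} {CM₂ δ₄ : ℝ}
    (hN : LocStencilFM Lc N₂ CM₂ δ₄) (hδ₄ : 0 < δ₄) :
    ∃ cW θW δW : ℝ, 0 ≤ θW ∧ θW < 1 ∧ 0 < δW ∧ ∀ k j, VertexFamily₂
      (W2SymOfK (unitK (sfStep Lc (k + j)) (smStep d Lc (k + j)) (coDressKBmAt (toSite r) Lc (KInvStep (d := d) Lc (k + j)))) Lc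
          (unitS (sfStep Lc (k + j)) (smStep d Lc (k + j)) (SpureRecAt d Lc (toSite r) cE cVH cΛ (k + j)))
          (unitM (sfStep Lc (k + j)) (smStep d Lc (k + j)) (M1At d Lc (toSite r) cΛ (k + j))) (U (k + j)) N₂ -
        W2SymOfK (unitK (sfStep Lc k) (smStep d Lc k) (coDressKBmAt (toSite r) Lc (KInvStep (d := d) Lc k))) Lc
          (unitS (sfStep Lc k) (smStep d Lc k) (SpureRecAt d Lc (toSite r) cE cVH cΛ k)) (unitM (sfStep Lc k) (smStep d Lc k) (M1At d Lc (toSite r) cΛ k))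
          (U k) N₂) Lc (cW * θW ^ k) δW := by
  have hC : 0 ≤ C := (hG 0).nonneg (Sum.inl 0)
  have hcK : 0 ≤ cK := by have h := (hGall 0 0).nonneg (Sum.inl 0); simpa using h
  have hCs : 0 ≤ Cs := ((hS 0) 0 0).nonneg (Sum.inl 0)
  have hcS : 0 ≤ cS := by have h := ((hSall 0 0) 0 0).nonneg (Sum.inl 0); simpa using h
  have hC₂ : 0 ≤ C₂ := (hU 0).nonneg
  have hc₂ : 0 ≤ c₂ := by have h := (hUd 0 0).nonneg; simpa using h
  have hCM₂ : 0 ≤ CM₂ := hN.nonneg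
  set θW : ℝ := max θK (max θS θ₂) with hθW_def
  have hθW0 : 0 ≤ θW := hθK0.trans (le_max_left _ _)
  have hθW1 : θW < 1 := max_lt hθK1 (max_lt hθS1 hθ₂1)
  have hKW : θK ≤ θW := le_max_left _ _
  have hSW : θS ≤ θW := (le_max_left _ _).trans (le_max_right _ _)
  have h2W : θ₂ ≤ θW := (le_max_right _ _).trans (le_max_right _ _)
  set m : ℝ := min δ (min δs (min δ₂ δ₄)) with hm_def
  have hm0 : 0 < m := lt_min hδ (lt_min hδs (lt_min hδ₂ hδ₄))
  have hmδ : m ≤ δ := min_le_left _ _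
  have hms : m ≤ δs := (min_le_right _ _).trans (min_le_left _ _)
  have hm2 : m ≤ δ₂ := (min_le_right _ _).trans ((min_le_right _ _).trans (min_le_left _ _))
  have hm4 : m ≤ δ₄ := (min_le_right _ _).trans ((min_le_right _ _).trans (min_le_right _ _))
  set CM : ℝ := |cΛ| * (2 * (ell (d + 1) Lc : ℝ) ^ 2 * Real.exp (4 * ((d : ℝ) + 1) * Lc * m)) with hCM_def
  have hM : VertexFamily (fun μ w => cΛ • hessFFAt (d := d) (toSite r) Lc μ w) Lc CM m := vertexFamily_smul_hessFFAt hLc hr cΛ hm0.le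
  have hNm : LocStencilFM Lc N₂ CM₂ m := hN.mono hm4
  refine ⟨LW2 d C Cs CM C₂ CM₂ cK cS 0 c₂ 0 m, θW, m / 16, hθW0, hθW1, by positivity, fun k j => ?_⟩
  have hK1 : Decays (unitK (sfStep Lc (k + j)) (smStep d Lc (k + j)) (coDressKBmAt (toSite r) Lc (KInvStep (d := d) Lc (k + j)))) C m :=
    decays_mono (hG (k + j)) hC le_rfl hmδ
  have hK0 : Decays (unitK (sfStep Lc k) (smStep d Lc k) (coDressKBmAt (toSite r) Lc (KInvStep (d := d) Lc k))) C m :=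
    decays_mono (hG k) hC le_rfl hmδ
  have hKK : Decays (unitK (sfStep Lc (k + j)) (smStep d Lc (k + j)) (coDressKBmAt (toSite r) Lc (KInvStep (d := d) Lc (k + j))) -
      unitK (sfStep Lc k) (smStep d Lc k) (coDressKBmAt (toSite r) Lc (KInvStep (d := d) Lc k))) (cK * θW ^ k) m :=
    decays_mono (hGall k j) (by positivity) (mul_pow_le_mul_pow hcK hθK0 hKW k) hmδ
  have hS1 : LocStencil (unitS (sfStep Lc (k + j)) (smStep d Lc (k + j)) (SpureRecAt d Lc (toSite r) cE cVH cΛ (k + j))) Cs m :=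
    locStencil_mono' (hS (k + j)) le_rfl hms
  have hS0 : LocStencil (unitS (sfStep Lc k) (smStep d Lc k) (SpureRecAt d Lc (toSite r) cE cVH cΛ k)) Cs m :=
    locStencil_mono' (hS k) le_rfl hms
  have hSS : LocStencil (unitS (sfStep Lc (k + j)) (smStep d Lc (k + j)) (SpureRecAt d Lc (toSite r) cE cVH cΛ (k + j)) -
      unitS (sfStep Lc k) (smStep d Lc k) (SpureRecAt d Lc (toSite r) cE cVH cΛ k)) (cS * θW ^ k) m :=
    locStencil_mono' (hSall k j) (mul_pow_le_mul_pow hcS hθS0 hSW k) hms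
  have hT1 : LocStencil₂ (U (k + j)) C₂ m := locStencil₂_le_mono (hU (k + j)) le_rfl hm2
  have hT0 : LocStencil₂ (U k) C₂ m := locStencil₂_le_mono (hU k) le_rfl hm2
  have hTT : LocStencil₂ (U (k + j) - U k) (c₂ * θW ^ k) m := locStencil₂_le_mono (hUd k j) (mul_pow_le_mul_pow hc₂ hθ₂0 h2W k) hm2
  have hθk : (0 : ℝ) ≤ 0 * θW ^ k := by positivity
  have hMM : VertexFamily ((fun μ w => cΛ • hessFFAt (d := d) (toSite r) Lc μ w) - fun μ w => cΛ • hessFFAt (d := d) (toSite r) Lc μ w) Lc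
      (0 * θW ^ k) m := by
    rw [sub_self]; exact vertexFamily_zero hθk
  have hMM₂ : LocStencilFM Lc (N₂ - N₂) (0 * θW ^ k) m := by
    rw [sub_self]; exact locStencilFM_zero hθk
  rw [unitM_M1At_eq, unitM_M1At_eq]
  have h := vertexFamily₂_W2SymOfK_sub (N := Lc) hK1 hK0 hKK hm0 hS1 hS0 hSS hM hM hMM hT1 hT0 hTT hNm hNm hMM₂
  rw [LW2_mul] at h
  exact h

end Carrier

/-! ## §3 Generic `d`: the W-slot rows (hW, hWall) of the EVEN HALF of `WrecAt` from «T2Shape^{ev}» ∧ «T2Drift^{ev}» and the first-order rows -/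

section EvenHalf

variable {Lc : ℕ} [NeZero Lc] {r : Fin (d + 1) → ℕ}

/-- NOT IN PRINT; OUR BOOKKEEPING — A SOCKET ([folklore] assembly; generic `d`, in-block root `r`; `ALPHA0-STATUS` link L9, RULING R-gan24p1-g33-1 (C2)).
**THE W-SLOT ROWS (hW, hWall) OF THE EVEN HALF `½ • (W⁰_j + P W⁰_j)` OF an2's RECURSIVE WALL FAMILY `W⁰ = WrecAt` AS FUNCTIONS OF THE DRESSED K-ROWS, «S′Shape» ∧
«S′Drift», AND THE TWO ROWS «T2Shape^{ev}» `hT₂` ∧ «T2Drift^{ev}» `hT₂d` OF THE EVEN MEMBER `½ • (T̃_j + P T̃_j)`, `T̃_j := unitS₂_j (T2RecAt … j)`** (+ the border binder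
`hB` and the mixed-table letters `hmix hfm hm`, which only size the raw tables).  Route: §1 `unitW_evenHalf_WrecAt` writes each member as the carrier on the even tables MINUS the
carrier at zero tables; §2 twice (tables `(T̃^{ev}, mixFF^{ev})` — `locStencilFM_evenHalf` — and `(0, 0)`); `VertexFamily₂` subtraction (`vertexFamily₂_sub'`) at the smaller
rate; for the Cauchy row `sub_sub_sub_comm`.  ONE ratio `θW < 1`, ONE rate `δW > 0` for both rows.  The odd half of `W⁰` is never touched. -/
theorem hW_hWall_evenHalf_WrecAt_of_shapes (hLc : 1 ≤ Lc) (hr : r ∈ box (d + 1) Lc) {C δ cK θK : ℝ}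
    (hG : ∀ j, Decays (unitK (sfStep Lc j) (smStep d Lc j) (coDressKBmAt (toSite r) Lc (KInvStep (d := d) Lc j))) C δ)
    (hGall : ∀ k j, Decays (unitK (sfStep Lc (k + j)) (smStep d Lc (k + j)) (coDressKBmAt (toSite r) Lc (KInvStep (d := d) Lc (k + j))) -
      unitK (sfStep Lc k) (smStep d Lc k) (coDressKBmAt (toSite r) Lc (KInvStep (d := d) Lc k))) (cK * θK ^ k) δ)
    (hδ : 0 < δ) (hθK0 : 0 ≤ θK) (hθK1 : θK < 1)
    (cE cVH cΛ cE₂ cB : ℝ) (T : Fin 4 → Fin 4 → Fin 4 → Fin 4 → ℝ)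
    {vh₂S : Fin (d + 1) → (Fin (d + 1) → ℤ) → Fin (d + 1) → (Fin (d + 1) → ℤ) → MKer (d + 1) (Fib d)}
    (hB : ∃ C δ : ℝ, 0 < δ ∧ LocStencil₂ vh₂S C δ)
    {mixFF : Fin (d + 1) → (Fin (d + 1) → ℤ) → Fin (d + 1) → (Fin (d + 1) → ℤ) → MKer (d + 1) (Fib d)}
    {Cs cS θS δs : ℝ} (hS : ∀ j, LocStencil (unitS (sfStep Lc j) (smStep d Lc j) (SpureRecAt d Lc (toSite r) cE cVH cΛ j)) Cs δs)
    (hSall : ∀ k j, LocStencil (unitS (sfStep Lc (k + j)) (smStep d Lc (k + j)) (SpureRecAt d Lc (toSite r) cE cVH cΛ (k + j)) -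
      unitS (sfStep Lc k) (smStep d Lc k) (SpureRecAt d Lc (toSite r) cE cVH cΛ k)) (cS * θS ^ k) δs)
    (hδs : 0 < δs) (hθS0 : 0 ≤ θS) (hθS1 : θS < 1)
    {C₂ c₂ θ₂ δ₂ : ℝ}
    (hT₂ : ∀ j, LocStencil₂ (((1 : ℝ) / 2) • (unitS₂ (sfStep Lc j) (smStep d Lc j) (T2RecAt d Lc (toSite r) cE cVH cΛ cE₂ cB T vh₂S mixFF j) +
      fun κ u κ' u' => sgnK (trK (unitS₂ (sfStep Lc j) (smStep d Lc j) (T2RecAt d Lc (toSite r) cE cVH cΛ cE₂ cB T vh₂S mixFF j) κ u κ' u')))) C₂ δ₂)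
    (hT₂d : ∀ k j, LocStencil₂ (((1 : ℝ) / 2) • (unitS₂ (sfStep Lc (k + j)) (smStep d Lc (k + j)) (T2RecAt d Lc (toSite r) cE cVH cΛ cE₂ cB T vh₂S mixFF (k + j)) +
        fun κ u κ' u' => sgnK (trK (unitS₂ (sfStep Lc (k + j)) (smStep d Lc (k + j)) (T2RecAt d Lc (toSite r) cE cVH cΛ cE₂ cB T vh₂S mixFF (k + j)) κ u κ' u'))) -
      ((1 : ℝ) / 2) • (unitS₂ (sfStep Lc k) (smStep d Lc k) (T2RecAt d Lc (toSite r) cE cVH cΛ cE₂ cB T vh₂S mixFF k) +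
        fun κ u κ' u' => sgnK (trK (unitS₂ (sfStep Lc k) (smStep d Lc k) (T2RecAt d Lc (toSite r) cE cVH cΛ cE₂ cB T vh₂S mixFF k) κ u κ' u')))) (c₂ * θ₂ ^ k) δ₂)
    (hδ₂ : 0 < δ₂) (hθ₂0 : 0 ≤ θ₂) (hθ₂1 : θ₂ < 1)
    {CM₂ δ₄ : ℝ} (hmix : LocStencilFM Lc mixFF CM₂ δ₄) (hδ₄ : 0 < δ₄)
    (hfm : ∀ κ u ρ w x z (α μ' : Fin (d + 1)), mixFF κ u ρ w x z (Sum.inl α) (Sum.inr μ') = 0)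
    (hm : ∀ κ u ρ w x z (μ' : Fin (d + 1)) (b : Fib d), mixFF κ u ρ w x z (Sum.inr μ') b = 0) :
    ∃ Cw cW θW δW : ℝ, 0 ≤ θW ∧ θW < 1 ∧ 0 < δW ∧
      (∀ j, VertexFamily₂ (unitW (sfStep Lc j) (smStep d Lc j) (fun μ y ν y' => ((1 : ℝ) / 2) •
        (WrecAt d Lc (toSite r) cE cVH cΛ cE₂ cB T vh₂S mixFF j μ y ν y' + sgnK (trK (WrecAt d Lc (toSite r) cE cVH cΛ cE₂ cB T vh₂S mixFF j μ y ν y'))))) Lc Cw δW) ∧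
      (∀ k j, VertexFamily₂ (unitW (sfStep Lc (k + j)) (smStep d Lc (k + j)) (fun μ y ν y' => ((1 : ℝ) / 2) •
          (WrecAt d Lc (toSite r) cE cVH cΛ cE₂ cB T vh₂S mixFF (k + j) μ y ν y' + sgnK (trK (WrecAt d Lc (toSite r) cE cVH cΛ cE₂ cB T vh₂S mixFF (k + j) μ y ν y')))) -
        unitW (sfStep Lc k) (smStep d Lc k) (fun μ y ν y' => ((1 : ℝ) / 2) •
          (WrecAt d Lc (toSite r) cE cVH cΛ cE₂ cB T vh₂S mixFF k μ y ν y' + sgnK (trK (WrecAt d Lc (toSite r) cE cVH cΛ cE₂ cB T vh₂S mixFF k μ y ν y'))))) Lc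
        (cW * θW ^ k) δW) := by
  have hmix' : ∃ C δ : ℝ, 0 < δ ∧ LocStencilFM Lc mixFF C δ := ⟨CM₂, δ₄, hδ₄, hmix⟩
  -- the even half of the `j`-free mixed table keeps its class; the zero tables are in every class
  have hNev : LocStencilFM Lc (fun κ u ρ w => (1 / 2 : ℝ) • (mixFF κ u ρ w + sgnK (trK (mixFF κ u ρ w)))) CM₂ δ₄ := locStencilFM_evenHalf hmix
  have hN0 : LocStencilFM Lc (0 : Fin (d + 1) → (Fin (d + 1) → ℤ) → Fin (d + 1) → (Fin (d + 1) → ℤ) → MKer (d + 1) (Fib d)) CM₂ δ₄ :=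
    locStencilFM_zero hmix.nonneg
  have hU0 : ∀ j : ℕ, LocStencil₂ ((fun _ : ℕ => (0 : Fin (d + 1) → (Fin (d + 1) → ℤ) → Fin (d + 1) → (Fin (d + 1) → ℤ) → MKer (d + 1) (Fib d))) j) 0 δ₂ :=
    fun _ => locStencil₂_zero_table
  have hU0d : ∀ k j : ℕ, LocStencil₂ ((fun _ : ℕ => (0 : Fin (d + 1) → (Fin (d + 1) → ℤ) → Fin (d + 1) → (Fin (d + 1) → ℤ) → MKer (d + 1) (Fib d))) (k + j) -
      (fun _ : ℕ => (0 : Fin (d + 1) → (Fin (d + 1) → ℤ) → Fin (d + 1) → (Fin (d + 1) → ℤ) → MKer (d + 1) (Fib d))) k) (0 * θ₂ ^ k) δ₂ := by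
    intro k j
    rw [sub_self, zero_mul]
    exact locStencil₂_zero_table
  -- §2 twice, uniform
  obtain ⟨CwA, δA, hδA, hA⟩ := vertexFamily₂_carrier_of_rows cE cVH cΛ hLc hr hG hδ hS hδs hT₂ hδ₂ hNev hδ₄
  obtain ⟨CwB, δB, hδB, hB0⟩ := vertexFamily₂_carrier_of_rows cE cVH cΛ hLc hr hG hδ hS hδs hU0 hδ₂ hN0 hδ₄
  -- §2 twice, Cauchy
  obtain ⟨cWA, θA, δA', hθA0, hθA1, hδA', hAd⟩ := vertexFamily₂_carrier_cauchy_of_rows cE cVH cΛ hLc hr hG hGall hδ hθK0 hθK1 hS hSall hδs hθS0 hθS1 hT₂ hT₂d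
    hδ₂ hθ₂0 hθ₂1 hNev hδ₄
  obtain ⟨cWB, θB, δB', hθB0, hθB1, hδB', hBd⟩ := vertexFamily₂_carrier_cauchy_of_rows cE cVH cΛ hLc hr hG hGall hδ hθK0 hθK1 hS hSall hδs hθS0 hθS1 hU0 hU0d
    hδ₂ hθ₂0 hθ₂1 hN0 hδ₄
  have hCwA : 0 ≤ CwA := ((hA 0) 0 0 0 0).nonneg (Sum.inl 0)
  have hCwB : 0 ≤ CwB := ((hB0 0) 0 0 0 0).nonneg (Sum.inl 0)
  have hcWA : 0 ≤ cWA := by have h := ((hAd 0 0) 0 0 0 0).nonneg (Sum.inl 0); simpa using h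
  have hcWB : 0 ≤ cWB := by have h := ((hBd 0 0) 0 0 0 0).nonneg (Sum.inl 0); simpa using h
  -- common ratio and rate
  set θW : ℝ := max θA θB with hθW_def
  have hθW0 : 0 ≤ θW := hθA0.trans (le_max_left _ _)
  have hθW1 : θW < 1 := max_lt hθA1 hθB1
  set δW : ℝ := min (min δA δB) (min δA' δB') with hδW_def
  have hδW : 0 < δW := lt_min (lt_min hδA hδB) (lt_min hδA' hδB')
  refine ⟨CwA + CwB, cWA + cWB, θW, δW, hθW0, hθW1, hδW, fun j => ?_, fun k j => ?_⟩
  · rw [unitW_evenHalf_WrecAt hLc hr cE cVH cΛ cE₂ cB T vh₂S mixFF hB hmix' (sfStep_ne_zero j) (smStep_ne_zero j) j, unitM₂_M2Of_eq hfm hm]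
    exact vertexFamily₂_sub' (vertexFamily₂_mono (hA j) hCwA ((min_le_left _ _).trans (min_le_left _ _)))
      (vertexFamily₂_mono (hB0 j) hCwB ((min_le_left _ _).trans (min_le_right _ _)))
  · rw [unitW_evenHalf_WrecAt hLc hr cE cVH cΛ cE₂ cB T vh₂S mixFF hB hmix' (sfStep_ne_zero (k + j)) (smStep_ne_zero (k + j)) (k + j),
      unitW_evenHalf_WrecAt hLc hr cE cVH cΛ cE₂ cB T vh₂S mixFF hB hmix' (sfStep_ne_zero k) (smStep_ne_zero k) k, unitM₂_M2Of_eq hfm hm,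
      unitM₂_M2Of_eq hfm hm, sub_sub_sub_comm, add_mul]
    exact vertexFamily₂_sub'
      (vertexFamily₂_mono' (hAd k j) (by positivity) (mul_pow_le_mul_pow hcWA hθA0 (le_max_left _ _) k) ((min_le_right _ _).trans (min_le_left _ _)))
      (vertexFamily₂_mono' (hBd k j) (by positivity) (mul_pow_le_mul_pow hcWB hθB0 (le_max_right _ _) k) ((min_le_right _ _).trans (min_le_right _ _)))

end EvenHalf


end Summit.QuantumFields.BalabanUV.Beta.GAN24.WrecAtEvenHalfRows

end
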